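import Summits.AtomisticToContinuum.Crystallization.Theorems.BrittleRungDescentMieRungLocLim
import Summits.AtomisticToContinuum.Crystallization.Theorems.BrittleRungDescentLadderGroundStates
import Summits.AtomisticToContinuum.Crystallization.Theorems.BrittleRungDescentMieRung
import Summits.AtomisticToContinuum.Crystallization.Theses.OneCentreSteepnessLadder

/-!
# Route `BrittleRungDescent`, item `MieRung` (stmt-AtomisticToContinuum-10946), VI: on the Mie
# ladder the Blanc–Lewin form of crystallization implies the energetic form

Conclusion of the series `BrittleRungDescentMieRung{Periodic, Limit, Matched, Finite, LocLim}`
(generic Lennard-Jones-like pair potentials), specialised to the rungs `V_q = miePotential q`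
(`V_q(r) = r^{-2q}/(2q) − r^{-q}/q`) of the Mie `(2q, q)` ladder:

* the generic hypotheses hold for every `q ≥ 6` — `V_q(0) = 0`, `V_q ≤ 0` on `[1, ∞)` and
  continuity on `(0, ∞)` (the tree's `LadderGroundStates.miePotential_zero`,
  `….miePotential_nonpos`, `….continuousOn_miePotential`), `neg_six_le_miePotential`
  (`−r⁻⁶/6 ≤ V_q(r)` on `(0, ∞)`, the SAME inverse-sixth-power floor as Lennard-Jones, uniformly
  in `q ≥ 6`), and STABILITY `le_interactionEnergy_miePotential` (`𝓔_{V_q}(x) ≥ −(31250/q)·N`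
  in `ℝ³`: closest pair + the shell sum `sum_inv_pow_six_le`, as for Lennard-Jones);
* `hasPeriodicGroundStateEnergy_miePotential_of_isCrystallizing` — for `q ≥ 6`, if the ground
  states of `V_q` exist for every `N` and are uniformly separated, then
  `IsCrystallizing V_q 3 → HasPeriodicGroundStateEnergy V_q 3`;
* **`mieRung_of_isCrystallizing : (∃ q₀, ∀ q ≥ q₀, IsCrystallizing (miePotential q) 3) →
  MieRung`** and **`mieRung_iff_eventually_isCrystallizing`** — with the route's support item
  `LadderGroundStates` PROVED (`LadderGroundStates_proof`: existence and `(1 − 2/q)`-separation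
  of ground states for `q ≥ 500`), the milestone `MieRung` IS its second conjunct: the energetic
  half `HasPeriodicGroundStateEnergy (miePotential q) 3` of the brittle rung is not an
  independent obligation.  (For the crux `BrittleBarlowRigidity`, whose conclusion is the body of
  `MieRung`, this means that only `IsCrystallizing (miePotential p) 3` has to be produced.)
* `mieRung_of_cruxes : SoftLocalHales → MieSoftKissing → BrittleBarlowRigidity → MieRung` — the
  route's rung chain (`BrittleRungDescentMieRung.mieRung_of_rung_chain`, item `RungAssembly`) with
  its `LadderGroundStates` hypothesis discharged: what the milestone still waits for are exactly
  the items `SoftLocalHales` (10944), `MieSoftKissing` (10943), `BrittleBarlowRigidity` (10942).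
* `oneCentreSteepnessLadder_mieRung_iff` — the sibling route `OneCentreSteepnessLadder` states the
  same shared item as its own decl `MieRung`, definitionally equal (`Iff.rfl`), so everything here
  applies to it verbatim.

All `[folklore]` (Blanc–Lewin 2015, §1.3, §2.1–§2.2).
-/

noncomputable section

open scoped BigOperators Topology
open Filter Set Metric

namespace Summit.AtomisticToContinuum.Crystallization.Theorems.MieRungEnergetic

open Literature.MathematicalPhysics.StatisticalMechanics
open Summit.AtomisticToContinuum.Crystallization.Theorems.ChargedEnergyGapNegative (E3)
open Summit.AtomisticToContinuum.Crystallization.Theses.BrittleRungDescent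

/-! ### The generic hypotheses on the Mie ladder -/

/-- **The inverse-sixth-power floor, uniformly on the ladder**: `−r⁻⁶/6 ≤ V_q(r)` for `r > 0`
and `q ≥ 6` (for `r ≥ 1`: `V_q(r) ≥ −r^{-q}/q ≥ −r⁻⁶/6`; for `r < 1`:
`V_q(r) ≥ −1/(2q) ≥ −1/12 ≥ −r⁻⁶/6`). [folklore] -/
theorem neg_six_le_miePotential {q : ℕ} (hq : 6 ≤ q) {r : ℝ} (hr : 0 < r) :
    -(1 / 6 * r⁻¹ ^ 6) ≤ miePotential q r := by
  have hq0 : q ≠ 0 := by omega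
  have hqr : (6 : ℝ) ≤ q := by exact_mod_cast hq
  have hqpos : (0 : ℝ) < q := by linarith
  rcases le_or_gt 1 r with hr1 | hr1
  · -- `r ≥ 1`: `r⁻¹ ≤ 1`
    have hinv0 : 0 ≤ r⁻¹ := inv_nonneg.2 hr.le
    have hinv1 : r⁻¹ ≤ 1 := inv_le_one_of_one_le₀ hr1
    have hpow : r⁻¹ ^ q ≤ r⁻¹ ^ 6 := pow_le_pow_of_le_one hinv0 hinv1 hq
    have hpow0 : 0 ≤ r⁻¹ ^ (2 * q) := by positivity
    have h6pos : 0 ≤ r⁻¹ ^ 6 := by positivity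
    rw [miePotential_apply]
    have h1 : 1 / (q : ℝ) * r⁻¹ ^ q ≤ 1 / 6 * r⁻¹ ^ 6 := by
      have hc : 1 / (q : ℝ) ≤ 1 / 6 := one_div_le_one_div_of_le (by norm_num) hqr
      exact mul_le_mul hc hpow (by positivity) (by norm_num)
    have h2 : 0 ≤ 1 / (2 * (q : ℝ)) * r⁻¹ ^ (2 * q) := by positivity
    linarith
  · -- `r < 1`: `r⁻¹ ^ 6 ≥ 1`
    have hinv1 : 1 ≤ r⁻¹ := (one_le_inv₀ hr).2 hr1.le
    have hpow : (1 : ℝ) ≤ r⁻¹ ^ 6 := one_le_pow₀ hinv1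
    have h1 := neg_one_div_le_miePotential hq0 r
    have h2 : -(1 / 6 * r⁻¹ ^ 6) ≤ -1 / (2 * (q : ℝ)) := by
      rw [neg_div, neg_le_neg_iff, div_le_iff₀ (by positivity)]
      nlinarith
    linarith

/-- **A particle with site energy `≥ −250²/(2q)`** (`q ≥ 6`): in every configuration of `N ≥ 2`
distinct points of `ℝ³`, at a closest pair `(i₀, j₀)` with `r = |x_{i₀} − x_{j₀}|`, all mutual
distances are `≥ r`, so with `w = r^{-q}` the site energy of `i₀` is
`≥ w²/(2q) − (1/q) Σ_k |x_{i₀} − x_k|^{-q} ≥ w²/(2q) − (250/q) w ≥ −250²/(2q)`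
(`Σ_k d_k^{-q} ≤ r^{-(q-6)} Σ_k d_k⁻⁶ ≤ 250 r^{-q}` by the shell sum). [folklore] -/
theorem exists_le_siteEnergy_miePotential {q : ℕ} (hq : 6 ≤ q) {N : ℕ} [Nontrivial (Fin N)]
    {x : Fin N → E3} (hx : Function.Injective x) :
    ∃ i, -(31250 / (q : ℝ)) ≤ siteEnergy (miePotential q) x i := by
  obtain ⟨i, j, hij⟩ := exists_pair_ne (Fin N)
  obtain ⟨p, hp, hmin⟩ := Finset.exists_min_image Finset.univ.offDiag
    (fun p : Fin N × Fin N => dist (x p.1) (x p.2)) ⟨(i, j), by simp [hij]⟩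
  obtain ⟨i₀, j₀⟩ := p
  have hij₀ : i₀ ≠ j₀ := by simpa using hp
  set r := dist (x i₀) (x j₀) with hr_def
  have hr : 0 < r := dist_pos.2 (hx.ne hij₀)
  have hsep : ∀ k l, k ≠ l → r ≤ dist (x k) (x l) := fun k l hkl => hmin (k, l) (by simp [hkl])
  refine ⟨i₀, ?_⟩
  have hqr : (6 : ℝ) ≤ q := by exact_mod_cast hq
  have hqpos : (0 : ℝ) < q := by linarith
  have hS := sum_inv_pow_six_le x hr hsep i₀
  -- `d_k^{-q} ≤ r^{-(q-6)} d_k^{-6}` termwise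
  have hterm : ∀ k ∈ Finset.univ.erase i₀,
      (dist (x i₀) (x k))⁻¹ ^ q ≤ r⁻¹ ^ (q - 6) * (dist (x i₀) (x k))⁻¹ ^ 6 := by
    intro k hk
    have hdk : r ≤ dist (x i₀) (x k) := hsep i₀ k (Finset.ne_of_mem_erase hk).symm
    have hdpos : 0 < dist (x i₀) (x k) := hr.trans_le hdk
    have hinv : (dist (x i₀) (x k))⁻¹ ≤ r⁻¹ := (inv_le_inv₀ hdpos hr).2 hdk
    have hinv0 : 0 ≤ (dist (x i₀) (x k))⁻¹ := inv_nonneg.2 hdpos.le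
    calc (dist (x i₀) (x k))⁻¹ ^ q = (dist (x i₀) (x k))⁻¹ ^ (q - 6) * (dist (x i₀) (x k))⁻¹ ^ 6 := by
          rw [← pow_add, Nat.sub_add_cancel hq]
      _ ≤ r⁻¹ ^ (q - 6) * (dist (x i₀) (x k))⁻¹ ^ 6 :=
          mul_le_mul_of_nonneg_right (pow_le_pow_left₀ hinv0 hinv _) (by positivity)
  have hsumq : ∑ k ∈ Finset.univ.erase i₀, (dist (x i₀) (x k))⁻¹ ^ q ≤ 250 * r⁻¹ ^ q :=
    calc ∑ k ∈ Finset.univ.erase i₀, (dist (x i₀) (x k))⁻¹ ^ q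
        ≤ ∑ k ∈ Finset.univ.erase i₀, r⁻¹ ^ (q - 6) * (dist (x i₀) (x k))⁻¹ ^ 6 :=
          Finset.sum_le_sum hterm
      _ = r⁻¹ ^ (q - 6) * ∑ k ∈ Finset.univ.erase i₀, (dist (x i₀) (x k))⁻¹ ^ 6 := by
          rw [Finset.mul_sum]
      _ ≤ r⁻¹ ^ (q - 6) * (250 * r⁻¹ ^ 6) := mul_le_mul_of_nonneg_left hS (by positivity)
      _ = 250 * r⁻¹ ^ q := by
          rw [show r⁻¹ ^ q = r⁻¹ ^ (q - 6) * r⁻¹ ^ 6 by rw [← pow_add, Nat.sub_add_cancel hq]]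
          ring
  -- the repulsive term of the closest partner
  have h2q : r⁻¹ ^ (2 * q) ≤ ∑ k ∈ Finset.univ.erase i₀, (dist (x i₀) (x k))⁻¹ ^ (2 * q) := by
    have hj : j₀ ∈ Finset.univ.erase i₀ := Finset.mem_erase.2 ⟨hij₀.symm, Finset.mem_univ _⟩
    exact Finset.single_le_sum (f := fun k => (dist (x i₀) (x k))⁻¹ ^ (2 * q))
      (fun k _ => by positivity) hj
  have hexp : siteEnergy (miePotential q) x i₀ =
      1 / (2 * (q : ℝ)) * ∑ k ∈ Finset.univ.erase i₀, (dist (x i₀) (x k))⁻¹ ^ (2 * q) -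
        1 / (q : ℝ) * ∑ k ∈ Finset.univ.erase i₀, (dist (x i₀) (x k))⁻¹ ^ q := by
    simp only [siteEnergy, miePotential_apply, Finset.sum_sub_distrib, Finset.mul_sum]
  have hsq : r⁻¹ ^ (2 * q) = (r⁻¹ ^ q) ^ 2 := by rw [pow_mul']
  rw [hsq] at h2q
  rw [hexp]
  set w : ℝ := r⁻¹ ^ q with hw
  set S₂ : ℝ := ∑ k ∈ Finset.univ.erase i₀, (dist (x i₀) (x k))⁻¹ ^ (2 * q) with hS₂
  set S₁ : ℝ := ∑ k ∈ Finset.univ.erase i₀, (dist (x i₀) (x k))⁻¹ ^ q with hS₁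
  -- `(1/(2q)) S₂ − (1/q) S₁ ≥ (1/(2q)) (w² − 500 w) ≥ −250²/(2q)`
  have hkey : w ^ 2 - 500 * w ≤ S₂ - 2 * S₁ := by linarith
  have hlow : -(62500 : ℝ) ≤ w ^ 2 - 500 * w := by nlinarith [sq_nonneg (w - 250)]
  have hrewrite : 1 / (2 * (q : ℝ)) * S₂ - 1 / (q : ℝ) * S₁ = 1 / (2 * (q : ℝ)) * (S₂ - 2 * S₁) := by
    field_simp
  rw [hrewrite]
  have hc : (0 : ℝ) < 1 / (2 * (q : ℝ)) := by positivity
  calc -(31250 / (q : ℝ)) = 1 / (2 * (q : ℝ)) * (-(62500 : ℝ)) := by field_simp; norm_num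
    _ ≤ 1 / (2 * (q : ℝ)) * (S₂ - 2 * S₁) := mul_le_mul_of_nonneg_left (hlow.trans hkey) hc.le

/-- **Stability of the Mie rungs.** For `q ≥ 6` and every configuration of `N` distinct points
of `ℝ³`, `𝓔_{V_q}(x) ≥ −(31250/q)·N` (induction on `N`, removing a particle with site energy
`≥ −31250/q`). [folklore] -/
theorem le_interactionEnergy_miePotential {q : ℕ} (hq : 6 ≤ q) :
    ∀ (N : ℕ) (x : Fin N → E3), Function.Injective x →
      -((31250 / (q : ℝ)) * (N : ℝ)) ≤ interactionEnergy (miePotential q) x := by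
  intro N
  induction N with
  | zero =>
    intro x hx
    rw [interactionEnergy_of_subsingleton]
    simp
  | succ n ih =>
    intro x hx
    rcases Nat.lt_or_ge n 1 with hn | hn
    · haveI : Subsingleton (Fin (n + 1)) := Fin.subsingleton_iff_le_one.2 (by omega)
      rw [interactionEnergy_of_subsingleton]
      exact neg_nonpos.2 (by positivity)
    · haveI : Nontrivial (Fin (n + 1)) := Fin.nontrivial_iff_two_le.2 (by omega)
      obtain ⟨i, hi⟩ := exists_le_siteEnergy_miePotential hq hx
      rw [interactionEnergy_eq_succAbove_add_siteEnergy (miePotential q)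
        (LadderGroundStates.miePotential_zero q) x i]
      have hih := ih (x ∘ i.succAbove) (hx.comp Fin.succAbove_right_injective)
      push_cast
      linarith

/-! ### Conjunct (ii) implies conjunct (i) on the Mie ladder -/

/-- **For `q ≥ 6`: `IsCrystallizing V_q 3 → HasPeriodicGroundStateEnergy V_q 3`**, provided the
ground states of `V_q` exist for every `N` and are uniformly separated. [folklore] -/
theorem hasPeriodicGroundStateEnergy_miePotential_of_isCrystallizing {q : ℕ} (hq : 6 ≤ q)
    (hex : ∀ N : ℕ, ∃ x : Fin N → E3, IsGroundState (miePotential q) x) {δ : ℝ} (hδ : 0 < δ)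
    (hsep : ∀ (N : ℕ) (x : Fin N → E3), IsGroundState (miePotential q) x →
      ∀ i j, i ≠ j → δ ≤ dist (x i) (x j))
    (h : IsCrystallizing (miePotential q) 3) :
    HasPeriodicGroundStateEnergy (miePotential q) 3 := by
  have hq0 : q ≠ 0 := by omega
  exact hasPeriodicGroundStateEnergy_of_isCrystallizing (A := 1 / 6) (C := 31250 / (q : ℝ))
    (LadderGroundStates.miePotential_zero q) (fun r hr => LadderGroundStates.miePotential_nonpos hq0 hr)
    (fun r hr => neg_six_le_miePotential hq hr) (by norm_num)
    (LadderGroundStates.continuousOn_miePotential q) (le_interactionEnergy_miePotential hq) hex hδ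
    hsep h

/-- **The brittle rung is its second conjunct.** Eventual crystallization in the Blanc–Lewin
form along the ladder implies `MieRung` (existence and `(1 − 2/q)`-separation of the ground
states for `q ≥ 500` is the PROVED support item `LadderGroundStates`). [folklore] -/
theorem mieRung_of_isCrystallizing :
    (∃ q₀ : ℕ, ∀ q : ℕ, q₀ ≤ q → IsCrystallizing (miePotential q) 3) → MieRung := by
  intro hC
  have hL := LadderGroundStates_proof
  dsimp only [LadderGroundStates, MieRung] at hL ⊢
  obtain ⟨q₁, hL⟩ := hL
  obtain ⟨q₀, hC⟩ := hC
  refine ⟨max (max q₀ q₁) 6, fun q hq => ?_⟩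
  have hq₀ : q₀ ≤ q := le_trans (le_trans (le_max_left _ _) (le_max_left _ _)) hq
  have hq₁ : q₁ ≤ q := le_trans (le_trans (le_max_right _ _) (le_max_left _ _)) hq
  have hq6 : 6 ≤ q := le_trans (le_max_right _ _) hq
  obtain ⟨hex, hsep⟩ := hL q hq₁
  have hδ : (0 : ℝ) < 1 - 2 / (q : ℝ) := by
    have hq6' : (6 : ℝ) ≤ q := by exact_mod_cast hq6
    have : 2 / (q : ℝ) ≤ 1 / 3 := by
      rw [div_le_iff₀ (by linarith)]
      linarith
    linarith
  exact ⟨hasPeriodicGroundStateEnergy_miePotential_of_isCrystallizing hq6 hex hδ hsep (hC q hq₀),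
    hC q hq₀⟩

/-- **`MieRung` ↔ eventual Blanc–Lewin crystallization along the Mie ladder.** [folklore] -/
theorem mieRung_iff_eventually_isCrystallizing :
    MieRung ↔ ∃ q₀ : ℕ, ∀ q : ℕ, q₀ ≤ q → IsCrystallizing (miePotential q) 3 := by
  refine ⟨fun h => ?_, mieRung_of_isCrystallizing⟩
  dsimp only [MieRung] at h
  obtain ⟨q₀, h⟩ := h
  exact ⟨q₀, fun q hq => (h q hq).2⟩

/-- **What `MieRung` still waits for.** The rung chain of the route (item `RungAssembly`,
`BrittleRungDescentMieRung.mieRung_of_rung_chain`) with the proved support item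
`LadderGroundStates` discharged: `SoftLocalHales → MieSoftKissing → BrittleBarlowRigidity →
MieRung`. [folklore] -/
theorem mieRung_of_cruxes : SoftLocalHales → MieSoftKissing → BrittleBarlowRigidity → MieRung :=
  fun hSLH hMSK hBBR =>
    BrittleRungDescentMieRung.mieRung_of_rung_chain hSLH LadderGroundStates_proof hMSK hBBR

/-- **The shared item in the sibling route.** `OneCentreSteepnessLadder.MieRung` (the same ledger
item stmt-AtomisticToContinuum-10946, restated in that route file) is definitionally the `MieRung`
of `BrittleRungDescent`. [folklore] -/
theorem oneCentreSteepnessLadder_mieRung_iff :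
    Summit.AtomisticToContinuum.Crystallization.Theses.OneCentreSteepnessLadder.MieRung ↔ MieRung :=
  Iff.rfl

/-- Hence also `OneCentreSteepnessLadder.MieRung ↔` eventual Blanc–Lewin crystallization along the
ladder. [folklore] -/
theorem oneCentreSteepnessLadder_mieRung_iff_eventually_isCrystallizing :
    Summit.AtomisticToContinuum.Crystallization.Theses.OneCentreSteepnessLadder.MieRung ↔
      ∃ q₀ : ℕ, ∀ q : ℕ, q₀ ≤ q → IsCrystallizing (miePotential q) 3 :=
  oneCentreSteepnessLadder_mieRung_iff.trans mieRung_iff_eventually_isCrystallizing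

end Summit.AtomisticToContinuum.Crystallization.Theorems.MieRungEnergetic

end
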